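import Mathlib
import HarnessLib

/-!
# Lehmann–Goerisch: Goerisch's `X b T` replacement lemma

Topic `Literature/Analysis/OperatorTheory`; proofs-layer file (seed of the STAGE-L kernel, see the pub-nsjs GAP-v4 §4 "TWO-STAGE COUNT").
In the Lehmann–Goerisch method for complementary (lower) eigenvalue bounds of `M(u,v) = λ N(u,v)` one needs, for each trial function `v_i`, the exact
solution `ũ_i` of `M(ũ_i, φ) = N(v_i, φ) ∀φ` — usually unavailable. Goerisch's device [cite: ZimmermannMertins1995, §1] (as quoted in arXiv:2512.23182, Thm 4.1′):
choose ANY auxiliary space `X` with a positive semidefinite form `b_G` and a linear `T : D → X` with `b_G(Tu, Tv) = M(u, v)`, and ANY `w_i ∈ X` with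
`b_G(w_i, Tφ) = N(v_i, φ) ∀φ`; then `b_G(w_i, w_i) ≥ M(ũ_i, ũ_i)`, so replacing the Gram matrix of the `ũ_i` by that of the `w_i` keeps the bounds rigorous.
Pure bilinear algebra. [cite: ZimmermannMertins1995, §1] [folklore]
-/

namespace Literature.Analysis.OperatorTheory

variable {D X : Type*} [AddCommGroup D] [Module ℝ D] [AddCommGroup X] [Module ℝ X]

/-- Expansion of a bilinear form on a finite combination against a Kronecker family (self-contained copy of the `ProjectionLowerBound` helper). [folklore] -/
private theorem lg_sum_sum_of_kronecker (b : LinearMap.BilinForm ℝ D) {k : ℕ} (u : Fin k → D) (d : Fin k → ℝ)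
    (hb : ∀ i j, b (u i) (u j) = if i = j then d i else 0) (c : Fin k → ℝ) :
    b (∑ i, c i • u i) (∑ j, c j • u j) = ∑ i, d i * c i ^ 2 := by
  simp only [map_sum, map_smul, LinearMap.sum_apply, LinearMap.smul_apply, smul_eq_mul, hb]
  refine Finset.sum_congr rfl fun i _ => ?_
  rw [Finset.mul_sum]
  simp only [mul_ite, mul_zero, Finset.sum_ite_eq', Finset.mem_univ, if_true]
  ring

/-- `b(tP − Q, tP − Q) = t² b(P,P) − 2t b(P,Q) + b(Q,Q)` for symmetric `b`. [folklore] -/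
private theorem lg_smul_sub_self (b : LinearMap.BilinForm ℝ D) (hsymm : ∀ x y, b x y = b y x) (t : ℝ) (P Q : D) :
    b (t • P - Q) (t • P - Q) = t ^ 2 * b P P - 2 * t * b P Q + b Q Q := by
  simp only [map_sub, map_smul, LinearMap.sub_apply, LinearMap.smul_apply, smul_eq_mul]
  rw [hsymm Q P]
  ring

/-- `f(P + Q, P + Q) = f(P,P) + 2 f(P,Q) + f(Q,Q)` for symmetric `f`. [folklore] -/
private theorem lg_add_self (f : LinearMap.BilinForm ℝ D) (hsymm : ∀ x y, f x y = f y x) (P Q : D) :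
    f (P + Q) (P + Q) = f P P + 2 * f P Q + f Q Q := by
  simp only [map_add, LinearMap.add_apply]
  rw [hsymm Q P]
  ring

/-- **Goerisch's XbT lemma.** If `b_G(T·, T·) = M`, `M(ũ, ·) = ℓ` and `b_G(w, T·) = ℓ` for the same linear functional `ℓ` (in the method,
`ℓ = N(v_i, ·)`), and `b_G` is symmetric positive semidefinite, then `M(ũ, ũ) ≤ b_G(w, w)`. [cite: ZimmermannMertins1995, §1] [folklore] -/
theorem goerisch_xbt_le (M : LinearMap.BilinForm ℝ D) (bG : LinearMap.BilinForm ℝ X) (T : D →ₗ[ℝ] X)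
    (hbG_symm : ∀ x y, bG x y = bG y x) (hbG_nonneg : ∀ x, 0 ≤ bG x x)
    (hT : ∀ u v, bG (T u) (T v) = M u v) (ℓ : D →ₗ[ℝ] ℝ) (ũ : D) (w : X)
    (hũ : ∀ φ, M ũ φ = ℓ φ) (hw : ∀ φ, bG w (T φ) = ℓ φ) :
    M ũ ũ ≤ bG w w := by
  -- ŵ := w − T ũ is bG-orthogonal to T ũ
  have horth : bG (w - T ũ) (T ũ) = 0 := by
    rw [map_sub, LinearMap.sub_apply, hw, hT, hũ, sub_self]
  have hsplit : bG w w = M ũ ũ + bG (w - T ũ) (w - T ũ) := by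
    have hw' : w = T ũ + (w - T ũ) := by abel
    conv_lhs => rw [hw']
    rw [lg_add_self bG hbG_symm (T ũ) (w - T ũ), hT, hbG_symm (T ũ) (w - T ũ), horth]
    ring
  rw [hsplit]
  linarith [hbG_nonneg (w - T ũ)]

/-- The same for Gram matrices along a finite family: with `ℓ_i`, `ũ_i`, `w_i` as above for each `i`, the quadratic forms satisfy
`∑ c_i c_j M(ũ_i, ũ_j) ≤ ∑ c_i c_j b_G(w_i, w_j)` for every coefficient vector `c` (apply the lemma to `∑ c_i ũ_i`, `∑ c_i w_i`, `∑ c_i ℓ_i`), i.e. the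
matrix `A₂^{Goerisch} − A₂^{Lehmann}` is positive semidefinite — the form in which the replacement enters Lehmann's generalized eigenproblem.
[cite: ZimmermannMertins1995, §1] [folklore] -/
theorem goerisch_xbt_le_sum {n : ℕ} (M : LinearMap.BilinForm ℝ D) (bG : LinearMap.BilinForm ℝ X) (T : D →ₗ[ℝ] X)
    (hbG_symm : ∀ x y, bG x y = bG y x) (hbG_nonneg : ∀ x, 0 ≤ bG x x)
    (hT : ∀ u v, bG (T u) (T v) = M u v) (ℓ : Fin n → D →ₗ[ℝ] ℝ) (ũ : Fin n → D) (w : Fin n → X)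
    (hũ : ∀ i φ, M (ũ i) φ = ℓ i φ) (hw : ∀ i φ, bG (w i) (T φ) = ℓ i φ) (c : Fin n → ℝ) :
    M (∑ i, c i • ũ i) (∑ i, c i • ũ i) ≤ bG (∑ i, c i • w i) (∑ i, c i • w i) := by
  refine goerisch_xbt_le M bG T hbG_symm hbG_nonneg hT (∑ i, c i • ℓ i) _ _ ?_ ?_
  · intro φ
    rw [map_sum, LinearMap.sum_apply, LinearMap.sum_apply]
    refine Finset.sum_congr rfl fun i _ => ?_
    rw [map_smul, LinearMap.smul_apply, LinearMap.smul_apply, hũ]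
  · intro φ
    rw [map_sum, LinearMap.sum_apply, LinearMap.sum_apply]
    refine Finset.sum_congr rfl fun i _ => ?_
    rw [map_smul, LinearMap.smul_apply, LinearMap.smul_apply, hw]

end Literature.Analysis.OperatorTheory

/-!
## Lehmann–Goerisch counting form (kernel of STAGE L)

The eigenvalue-enclosure theorem itself [cite: ZimmermannMertins1995, §1] (Lehmann 1949/50, Goerisch–Haunhorst 1985, Goerisch–Albrecht 1986;
Zimmermann–Mertins for arbitrary essential spectrum) is stated over a self-adjoint spectral decomposition. As for `liu_count_bound`, we isolate the
part that is pure bilinear algebra: the spectral input is the finite family `φ₁..φ_m` of `M`-orthonormal eigenvectors with eigenvalues `0 < λ_i < ρ`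
together with the coercivity `M ≥ ρ N` on their `M`-orthogonal complement (in the application: the spectral theorem + the STAGE-R rough bound
`λ_{m+1} ≥ ρ`); the computational input is a `k`-parameter family `y ↦ (U y, W y)` of trial functions and Goerisch vectors on which the Lehmann
matrices satisfy `A ≤ ν B`, `B > 0`, `ν < 0` (in the application: the span of the `k` lowest eigenvectors of `A z = ν B z`, certified by interval
arithmetic). Conclusion: at least `k` of the `λ_i` lie in `[ρ − ρ/(1−ν), ρ)`.
-/

namespace Literature.Analysis.OperatorTheory

variable {D X : Type*} [AddCommGroup D] [Module ℝ D] [AddCommGroup X] [Module ℝ X]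

/-- Bessel's inequality for a symmetric positive semidefinite bilinear form and a finite orthonormal family. [folklore] -/
theorem bilin_bessel (f : LinearMap.BilinForm ℝ X) (hsymm : ∀ x y, f x y = f y x) (hnonneg : ∀ x, 0 ≤ f x x)
    {m : ℕ} (e : Fin m → X) (he : ∀ i j, f (e i) (e j) = if i = j then 1 else 0) (g : X) :
    ∑ i, f g (e i) ^ 2 ≤ f g g := by
  set p : X := ∑ i, f g (e i) • e i with hp
  have hpp : f p p = ∑ i, f g (e i) ^ 2 := by
    rw [hp, lg_sum_sum_of_kronecker f e (fun _ => (1 : ℝ)) (by simpa using he)]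
    simp
  have hgp : f g p = ∑ i, f g (e i) ^ 2 := by
    rw [hp, map_sum]
    refine Finset.sum_congr rfl fun i _ => ?_
    rw [map_smul, smul_eq_mul]; ring
  have h0 : 0 ≤ f (g - p) (g - p) := hnonneg _
  have hexp : f (g - p) (g - p) = f g g - 2 * f g p + f p p := by
    simp only [map_sub, LinearMap.sub_apply]; rw [hsymm p g]; ring
  rw [hexp, hgp, hpp] at h0
  linarith

/-- **Lehmann–Goerisch, counting form.** Setting: `M, N` symmetric bilinear forms on `D`; Goerisch's auxiliary space `(X, b_G)` (symmetric,
positive semidefinite) with `b_G(Tu, Tv) = M(u, v)`. Spectral input: `M`-orthonormal eigenvectors `φ_i` (`M(φ_i, ·) = λ_i N(φ_i, ·)`) with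
`0 < λ_i < ρ`, `i < m`, and `ρ N(ψ,ψ) ≤ M(ψ,ψ)` for every `ψ` `M`-orthogonal to all `φ_i`. Computational input: linear families `U : ℝ^k → D`
(trial functions), `W : ℝ^k → X` (Goerisch vectors, `b_G(W y, Tψ) = N(U y, ψ)`), a number `ν < 0` with
`M(u,u) − ρN(u,u) ≤ ν·(M(u,u) − 2ρN(u,u) + ρ² b_G(ω,ω))` for `u = U y, ω = W y`, and positivity of the bracket for `y ≠ 0`.
Conclusion: at least `k` indices `i` have `ρ − ρ/(1−ν) ≤ λ_i` (`< ρ`): the interval `[ρ − ρ/(1−ν), ρ)` holds ≥ `k` eigenvalues.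
[cite: ZimmermannMertins1995, §1] [folklore] -/
theorem lehmann_goerisch_count
    (M N : LinearMap.BilinForm ℝ D) (bG : LinearMap.BilinForm ℝ X) (T : D →ₗ[ℝ] X)
    (hM_symm : ∀ x y, M x y = M y x) (hN_symm : ∀ x y, N x y = N y x)
    (hbG_symm : ∀ x y, bG x y = bG y x) (hbG_nonneg : ∀ x, 0 ≤ bG x x)
    (hT : ∀ u v, bG (T u) (T v) = M u v)
    {m : ℕ} (φ : Fin m → D) (lam : Fin m → ℝ) {ρ : ℝ}
    (hφ_on : ∀ i j, M (φ i) (φ j) = if i = j then 1 else 0)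
    (hφ_eig : ∀ i ψ, M (φ i) ψ = lam i * N (φ i) ψ)
    (hlam_pos : ∀ i, 0 < lam i) (hlam_lt : ∀ i, lam i < ρ)
    (hcompl : ∀ ψ, (∀ i, M (φ i) ψ = 0) → ρ * N ψ ψ ≤ M ψ ψ)
    {k : ℕ} (U : (Fin k → ℝ) →ₗ[ℝ] D) (W : (Fin k → ℝ) →ₗ[ℝ] X)
    (hW : ∀ y ψ, bG (W y) (T ψ) = N (U y) ψ) {ν : ℝ} (hν : ν < 0)
    (hAB : ∀ y, M (U y) (U y) - ρ * N (U y) (U y)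
      ≤ ν * (M (U y) (U y) - 2 * ρ * N (U y) (U y) + ρ ^ 2 * bG (W y) (W y)))
    (hBpos : ∀ y, y ≠ 0 → 0 < M (U y) (U y) - 2 * ρ * N (U y) (U y) + ρ ^ 2 * bG (W y) (W y)) :
    k ≤ Fintype.card {i : Fin m // ρ - ρ / (1 - ν) ≤ lam i} := by
  classical
  by_contra hlt
  push Not at hlt
  set L : ℝ := ρ - ρ / (1 - ν) with hL
  -- a nonzero parameter y whose trial function is M-orthogonal to every φ_i with L ≤ λ_i
  let Φ : (Fin k → ℝ) →ₗ[ℝ] ({i : Fin m // L ≤ lam i} → ℝ) :=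
    LinearMap.pi fun i => (M (φ i.1)) ∘ₗ U
  have hrank : Module.finrank ℝ ({i : Fin m // L ≤ lam i} → ℝ) < Module.finrank ℝ (Fin k → ℝ) := by
    simpa [Module.finrank_fintype_fun_eq_card] using hlt
  obtain ⟨y, hyker, hy0⟩ :=
    Submodule.exists_mem_ne_zero_of_ne_bot (LinearMap.ker_ne_bot_of_finrank_lt hrank (f := Φ))
  have hcJ : ∀ i : Fin m, L ≤ lam i → M (φ i) (U y) = 0 := by
    intro i hi
    have h := congr_fun (LinearMap.mem_ker.mp hyker) ⟨i, hi⟩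
    simpa [Φ, LinearMap.pi_apply] using h
  set u : D := U y with hu
  set ω : X := W y with hω
  set c : Fin m → ℝ := fun i => M (φ i) u with hc
  set t : Fin m → ℝ := fun i => 1 - ρ / lam i with ht
  have hlam_ne : ∀ i, lam i ≠ 0 := fun i => (hlam_pos i).ne'
  -- N on the eigenvectors
  have hNφ : ∀ i ψ, N (φ i) ψ = M (φ i) ψ / lam i := by
    intro i ψ; rw [eq_div_iff (hlam_ne i), hφ_eig i ψ]; ring
  have hN_on : ∀ i j, N (φ i) (φ j) = if i = j then 1 / lam i else 0 := by
    intro i j; rw [hNφ, hφ_on]; split_ifs <;> simp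
  -- decomposition u = p + ψ
  set p : D := ∑ i, c i • φ i with hp
  set ψ : D := u - p with hψ
  have hMφψ : ∀ i, M (φ i) ψ = 0 := by
    intro i
    rw [hψ, map_sub, hp, map_sum]
    simp only [map_smul, smul_eq_mul, hφ_on, mul_ite, mul_one, mul_zero, Finset.sum_ite_eq, Finset.mem_univ,
      if_true]
    simp [hc]
  have hNφψ : ∀ i, N (φ i) ψ = 0 := by
    intro i; rw [hNφ, hMφψ]; simp
  have hMpp : M p p = ∑ i, c i ^ 2 := by
    rw [hp, lg_sum_sum_of_kronecker M φ (fun _ => (1 : ℝ)) (by simpa using hφ_on)]; simp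
  have hNpp : N p p = ∑ i, c i ^ 2 / lam i := by
    rw [hp, lg_sum_sum_of_kronecker N φ (fun i => 1 / lam i) (by simpa using hN_on)]
    refine Finset.sum_congr rfl fun i _ => ?_
    field_simp
  have hMpψ : M p ψ = 0 := by
    rw [hp, map_sum, LinearMap.sum_apply]
    refine Finset.sum_eq_zero fun i _ => ?_
    rw [map_smul, LinearMap.smul_apply, hMφψ, smul_zero]
  have hNpψ : N p ψ = 0 := by
    rw [hp, map_sum, LinearMap.sum_apply]
    refine Finset.sum_eq_zero fun i _ => ?_
    rw [map_smul, LinearMap.smul_apply, hNφψ, smul_zero]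
  have hupψ : u = p + ψ := by rw [hψ]; abel
  have hMuu : M u u = ∑ i, c i ^ 2 + M ψ ψ := by
    rw [hupψ, lg_add_self M hM_symm, hMpp, hMpψ]; ring
  have hNuu : N u u = ∑ i, c i ^ 2 / lam i + N ψ ψ := by
    rw [hupψ, lg_add_self N hN_symm, hNpp, hNpψ]; ring
  -- Step A: the A-form dominates Σ c_i² t_i
  have hψcoer : ρ * N ψ ψ ≤ M ψ ψ := hcompl ψ hMφψ
  have hA_ge : ∑ i, c i ^ 2 * t i ≤ M u u - ρ * N u u := by
    have e : ∑ i, c i ^ 2 * t i = ∑ i, c i ^ 2 - ρ * ∑ i, c i ^ 2 / lam i := by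
      rw [Finset.mul_sum, ← Finset.sum_sub_distrib]
      refine Finset.sum_congr rfl fun i _ => ?_
      rw [ht]; ring
    rw [e, hMuu, hNuu]; nlinarith [hψcoer]
  -- Step B: the B-form equals b_G(g,g), g = ρ•ω − T u, and Bessel against the orthonormal family T φ_i
  set g : X := ρ • ω - T u with hg
  have hBg : bG g g = M u u - 2 * ρ * N u u + ρ ^ 2 * bG ω ω := by
    rw [hg, lg_smul_sub_self bG hbG_symm ρ ω (T u), hT, hω, hW y u, hu]; ring
  have hTon : ∀ i j, bG (T (φ i)) (T (φ j)) = if i = j then 1 else 0 := by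
    intro i j; rw [hT, hφ_on]
  have hgφ : ∀ i, bG g (T (φ i)) = -(c i * t i) := by
    intro i
    have h1 : M u (φ i) = c i := by rw [hc, hM_symm]
    have h2 : N u (φ i) = c i / lam i := by rw [hN_symm, hNφ, hc]
    have h3 : bG g (T (φ i)) = ρ * N u (φ i) - M u (φ i) := by
      rw [hg, map_sub, map_smul, LinearMap.sub_apply, LinearMap.smul_apply, smul_eq_mul, hω, hW y (φ i), hT, ← hu]
    rw [h3, h1, h2, ht]
    ring
  have hB_ge : ∑ i, c i ^ 2 * t i ^ 2 ≤ M u u - 2 * ρ * N u u + ρ ^ 2 * bG ω ω := by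
    rw [← hBg]
    have hb := bilin_bessel bG hbG_symm hbG_nonneg (fun i => T (φ i)) hTon g
    calc ∑ i, c i ^ 2 * t i ^ 2 = ∑ i, bG g (T (φ i)) ^ 2 := by
          refine Finset.sum_congr rfl fun i _ => ?_; rw [hgφ]; ring
      _ ≤ bG g g := hb
  -- Step C: combine A ≤ ν B
  have hABy := hAB y
  rw [← hu, ← hω] at hABy
  have hsum : ∑ i, c i ^ 2 * (t i - ν * t i ^ 2) ≤ 0 := by
    have e : ∑ i, c i ^ 2 * (t i - ν * t i ^ 2) = ∑ i, c i ^ 2 * t i - ν * ∑ i, c i ^ 2 * t i ^ 2 := by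
      rw [Finset.mul_sum, ← Finset.sum_sub_distrib]
      refine Finset.sum_congr rfl fun i _ => ?_; ring
    rw [e]
    nlinarith [hA_ge, hB_ge, hABy, hν]
  -- every term is ≥ 0: c_i = 0 when L ≤ λ_i, coefficient > 0 when λ_i < L
  have hcoef_pos : ∀ i, lam i < L → 0 < t i - ν * t i ^ 2 := by
    intro i hi
    have h1ν : 0 < 1 - ν := by linarith
    have key : lam i * (1 - ν) < -(ν * ρ) := by
      have h := mul_lt_mul_of_pos_right hi h1ν
      rw [hL, sub_mul, div_mul_cancel₀ _ h1ν.ne'] at h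
      linarith
    have hli : lam i ≠ 0 := hlam_ne i
    have e : t i - ν * t i ^ 2 = (lam i - ρ) * (lam i * (1 - ν) + ν * ρ) / lam i ^ 2 := by
      rw [ht]; field_simp; try ring
    rw [e]
    apply div_pos _ (pow_pos (hlam_pos i) 2)
    apply mul_pos_of_neg_of_neg <;> linarith [hlam_lt i]
  have hterm_nonneg : ∀ i, 0 ≤ c i ^ 2 * (t i - ν * t i ^ 2) := by
    intro i
    by_cases hi : L ≤ lam i
    · have : c i = 0 := by rw [hc]; exact hcJ i hi
      rw [this]; simp
    · push Not at hi
      exact mul_nonneg (sq_nonneg _) (hcoef_pos i hi).le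
  have hall : ∀ i, c i ^ 2 * (t i - ν * t i ^ 2) = 0 := by
    have := (Finset.sum_eq_zero_iff_of_nonneg fun i _ => hterm_nonneg i).mp
      (le_antisymm hsum (Finset.sum_nonneg fun i _ => hterm_nonneg i))
    exact fun i => this i (Finset.mem_univ i)
  have hc0 : ∀ i, c i = 0 := by
    intro i
    by_cases hi : L ≤ lam i
    · rw [hc]; exact hcJ i hi
    · push Not at hi
      have h := hall i
      rcases mul_eq_zero.mp h with h | h
      · exact pow_eq_zero_iff (n := 2) (by norm_num) |>.mp h
      · exact absurd h (hcoef_pos i hi).ne'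
  -- hence A ≥ 0, but A ≤ ν B < 0
  have hA0 : 0 ≤ M u u - ρ * N u u := by
    have : ∑ i, c i ^ 2 * t i = 0 := Finset.sum_eq_zero fun i _ => by rw [hc0 i]; simp
    linarith [hA_ge]
  have hB0 : 0 < M u u - 2 * ρ * N u u + ρ ^ 2 * bG ω ω := by
    have := hBpos y hy0; rwa [← hu, ← hω] at this
  have : ν * (M u u - 2 * ρ * N u u + ρ ^ 2 * bG ω ω) < 0 := mul_neg_of_neg_of_pos hν hB0
  linarith [hABy]

/-- **Spectral cut from the enclosed eigenpairs** (the `hcut` input of the capacitance/resolvent step). In the Lehmann–Goerisch setting —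
`M`-orthonormal eigenpairs `(λ_i, φ_i)` exhausting the spectrum below `ρ` (i.e. `M ≥ ρN` on their `M`-orthogonal complement), `N ≥ 0`, `λ_i > 0` — every
`u` that is `M`-orthogonal (equivalently `N`-orthogonal) to the eigenvectors with `λ_i < β`, `β ≤ ρ`, satisfies `β N(u,u) ≤ M(u,u)`. With `M = h + c⟨·,·⟩`,
`N = ⟨·,·⟩` this is `h ≥ β − c` on the orthogonal complement of the enclosed eigenvectors below the cut. [folklore] -/
theorem form_cut_of_orthogonal
    (M N : LinearMap.BilinForm ℝ D) (hM_symm : ∀ x y, M x y = M y x) (hN_symm : ∀ x y, N x y = N y x)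
    (hN_nonneg : ∀ x, 0 ≤ N x x)
    {m : ℕ} (φ : Fin m → D) (lam : Fin m → ℝ) {ρ β : ℝ} (hβρ : β ≤ ρ)
    (hφ_on : ∀ i j, M (φ i) (φ j) = if i = j then 1 else 0)
    (hφ_eig : ∀ i ψ, M (φ i) ψ = lam i * N (φ i) ψ)
    (hlam_pos : ∀ i, 0 < lam i)
    (hcompl : ∀ ψ, (∀ i, M (φ i) ψ = 0) → ρ * N ψ ψ ≤ M ψ ψ)
    (u : D) (hcJ : ∀ i, lam i < β → M (φ i) u = 0) :
    β * N u u ≤ M u u := by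
  classical
  set c : Fin m → ℝ := fun i => M (φ i) u with hc
  have hlam_ne : ∀ i, lam i ≠ 0 := fun i => (hlam_pos i).ne'
  have hNφ : ∀ i ψ, N (φ i) ψ = M (φ i) ψ / lam i := by
    intro i ψ; rw [eq_div_iff (hlam_ne i), hφ_eig i ψ]; ring
  have hN_on : ∀ i j, N (φ i) (φ j) = if i = j then 1 / lam i else 0 := by
    intro i j; rw [hNφ, hφ_on]; split_ifs <;> simp
  set p : D := ∑ i, c i • φ i with hp
  set ψ : D := u - p with hψ
  have hMφψ : ∀ i, M (φ i) ψ = 0 := by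
    intro i
    rw [hψ, map_sub, hp, map_sum]
    simp only [map_smul, smul_eq_mul, hφ_on, mul_ite, mul_one, mul_zero, Finset.sum_ite_eq, Finset.mem_univ,
      if_true]
    simp [hc]
  have hNφψ : ∀ i, N (φ i) ψ = 0 := by
    intro i; rw [hNφ, hMφψ]; simp
  have hMpp : M p p = ∑ i, c i ^ 2 := by
    rw [hp, lg_sum_sum_of_kronecker M φ (fun _ => (1 : ℝ)) (by simpa using hφ_on)]; simp
  have hNpp : N p p = ∑ i, c i ^ 2 / lam i := by
    rw [hp, lg_sum_sum_of_kronecker N φ (fun i => 1 / lam i) (by simpa using hN_on)]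
    refine Finset.sum_congr rfl fun i _ => ?_
    field_simp
  have hMpψ : M p ψ = 0 := by
    rw [hp, map_sum, LinearMap.sum_apply]
    refine Finset.sum_eq_zero fun i _ => ?_
    rw [map_smul, LinearMap.smul_apply, hMφψ, smul_zero]
  have hNpψ : N p ψ = 0 := by
    rw [hp, map_sum, LinearMap.sum_apply]
    refine Finset.sum_eq_zero fun i _ => ?_
    rw [map_smul, LinearMap.smul_apply, hNφψ, smul_zero]
  have hupψ : u = p + ψ := by rw [hψ]; abel
  have hMuu : M u u = ∑ i, c i ^ 2 + M ψ ψ := by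
    rw [hupψ, lg_add_self M hM_symm, hMpp, hMpψ]; ring
  have hNuu : N u u = ∑ i, c i ^ 2 / lam i + N ψ ψ := by
    rw [hupψ, lg_add_self N hN_symm, hNpp, hNpψ]; ring
  -- each term c_i² (1 − β/λ_i) is ≥ 0: either c_i = 0 (λ_i < β) or λ_i ≥ β
  have hterm : ∀ i, 0 ≤ c i ^ 2 - β * (c i ^ 2 / lam i) := by
    intro i
    by_cases hi : lam i < β
    · have : c i = 0 := by rw [hc]; exact hcJ i hi
      rw [this]; simp
    · push Not at hi
      have hli := hlam_pos i
      have e : c i ^ 2 - β * (c i ^ 2 / lam i) = c i ^ 2 * ((lam i - β) / lam i) := by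
        field_simp
      rw [e]
      exact mul_nonneg (sq_nonneg _) (div_nonneg (by linarith) hli.le)
  have hsum : 0 ≤ ∑ i, c i ^ 2 - β * ∑ i, c i ^ 2 / lam i := by
    rw [Finset.mul_sum, ← Finset.sum_sub_distrib]
    exact Finset.sum_nonneg fun i _ => hterm i
  have hψN := hN_nonneg ψ
  have hψc := hcompl ψ hMφψ
  rw [hMuu, hNuu]; nlinarith [hsum, hψN, hψc, hβρ]

/-- **Rayleigh–Ritz counting form** (upper eigenvalue bounds ⇒ a lower bound on the COUNT below `β`): if an `n`-dimensional trial family has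
`M(u,u) < β N(u,u)` for all its non-zero members (certified: `β A1 − A0 ≻ 0` on the trial Gram matrices, `rr_hypothesis_of_matrices`), then at
least `n` of the eigenvalues below `ρ ≥ β` are `< β`. [folklore] -/
theorem rayleigh_ritz_count
    (M N : LinearMap.BilinForm ℝ D) (hM_symm : ∀ x y, M x y = M y x) (hN_symm : ∀ x y, N x y = N y x)
    (hN_nonneg : ∀ x, 0 ≤ N x x)
    {m : ℕ} (φ : Fin m → D) (lam : Fin m → ℝ) {ρ β : ℝ} (hβρ : β ≤ ρ)
    (hφ_on : ∀ i j, M (φ i) (φ j) = if i = j then 1 else 0)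
    (hφ_eig : ∀ i ψ, M (φ i) ψ = lam i * N (φ i) ψ)
    (hlam_pos : ∀ i, 0 < lam i)
    (hcompl : ∀ ψ, (∀ i, M (φ i) ψ = 0) → ρ * N ψ ψ ≤ M ψ ψ)
    {n : ℕ} (U : (Fin n → ℝ) →ₗ[ℝ] D)
    (hU : ∀ y, y ≠ 0 → M (U y) (U y) < β * N (U y) (U y)) :
    n ≤ Fintype.card {i : Fin m // lam i < β} := by
  classical
  by_contra hlt
  push Not at hlt
  let Φ : (Fin n → ℝ) →ₗ[ℝ] ({i : Fin m // lam i < β} → ℝ) :=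
    LinearMap.pi fun i => (M (φ i.1)) ∘ₗ U
  have hrank : Module.finrank ℝ ({i : Fin m // lam i < β} → ℝ) < Module.finrank ℝ (Fin n → ℝ) := by
    simpa [Module.finrank_fintype_fun_eq_card] using hlt
  obtain ⟨y, hyker, hy0⟩ :=
    Submodule.exists_mem_ne_zero_of_ne_bot (LinearMap.ker_ne_bot_of_finrank_lt hrank (f := Φ))
  have hcJ : ∀ i : Fin m, lam i < β → M (φ i) (U y) = 0 := by
    intro i hi
    have h := congr_fun (LinearMap.mem_ker.mp hyker) ⟨i, hi⟩
    simpa [Φ, LinearMap.pi_apply] using h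
  have hge := form_cut_of_orthogonal M N hM_symm hN_symm hN_nonneg φ lam hβρ hφ_on hφ_eig hlam_pos hcompl (U y) hcJ
  have hlt' := hU y hy0
  linarith

/-- **Two-stage exact count.** With `m` eigenvalues below `ρ` in total (STAGE R: `m ≤ n + k`), a Rayleigh–Ritz count `n ≤ #{λ_i < β}` and a
Lehmann–Goerisch count `k ≤ #{L ≤ λ_i}` with `β ≤ L`, the number of eigenvalues below `β` is exactly `n`. [folklore] -/
theorem two_stage_exact_count {m : ℕ} (lam : Fin m → ℝ) {β L : ℝ} (hβL : β ≤ L) {n k : ℕ}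
    (hm : m ≤ n + k) (hRR : n ≤ Fintype.card {i : Fin m // lam i < β})
    (hLG : k ≤ Fintype.card {i : Fin m // L ≤ lam i}) :
    Fintype.card {i : Fin m // lam i < β} = n := by
  classical
  have hdisj : Fintype.card {i : Fin m // lam i < β} + Fintype.card {i : Fin m // L ≤ lam i} ≤ m := by
    rw [Fintype.card_subtype, Fintype.card_subtype, ← Finset.card_union_of_disjoint]
    · calc (Finset.univ.filter (fun i : Fin m => lam i < β) ∪ Finset.univ.filter (fun i => L ≤ lam i)).card
          ≤ (Finset.univ : Finset (Fin m)).card := Finset.card_le_card (Finset.subset_univ _)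
        _ = m := by simp
    · rw [Finset.disjoint_filter]
      intro i _ h1 h2
      linarith
  omega

section MatrixGlue
open Matrix

/-- A bilinear form on a finite combination is the matrix quadratic form of its Gram matrix. [folklore] -/
private theorem lg_bilin_combo (b : LinearMap.BilinForm ℝ D) (hsymm : ∀ x y, b x y = b y x) {n : ℕ} (v : Fin n → D)
    (A : Matrix (Fin n) (Fin n) ℝ) (hA : ∀ i j, A i j = b (v i) (v j)) (x : Fin n → ℝ) :
    b (∑ i, x i • v i) (∑ j, x j • v j) = x ⬝ᵥ (A *ᵥ x) := by
  simp only [map_sum, map_smul, LinearMap.sum_apply, LinearMap.smul_apply, smul_eq_mul, dotProduct,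
    Matrix.mulVec, hA]
  simp only [Finset.mul_sum]
  refine Finset.sum_congr rfl fun i _ => Finset.sum_congr rfl fun j _ => ?_
  rw [hsymm (v j) (v i)]
  ring

/-- Congruence: the quadratic form of `Zᵀ C Z` at `y` is that of `C` at `Z y`. [folklore] -/
private theorem lg_congr_form {n k : ℕ} (C : Matrix (Fin n) (Fin n) ℝ) (Z : Matrix (Fin n) (Fin k) ℝ) (y : Fin k → ℝ) :
    y ⬝ᵥ ((Zᵀ * C * Z) *ᵥ y) = (Z *ᵥ y) ⬝ᵥ (C *ᵥ (Z *ᵥ y)) := by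
  rw [← Matrix.mulVec_mulVec, ← Matrix.mulVec_mulVec, Matrix.dotProduct_mulVec, Matrix.vecMul_transpose]

/-- **From certified matrices to the hypotheses of `lehmann_goerisch_count`.** Let `A0, A1, A2` be the Gram matrices `M(v_i,v_j)`, `N(v_i,v_j)`,
`b_G(w_i,w_j)` of the trial functions and Goerisch vectors, `A = A0 − ρA1`, `B = A0 − 2ρA1 + ρ²A2`, and `Z` an `n × k` coefficient matrix
(FLOAT approximate pencil eigenvectors suffice) with `Z y = 0 ⇒ y = 0`. If `ν ZᵀBZ − ZᵀAZ ⪰ 0` (interval Cholesky/LDLᵀ of a `k × k` matrix) and `B ≻ 0`,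
then the family `U y = Σ_j (Zy)_j v_j`, `W y = Σ_j (Zy)_j w_j` satisfies the two computational hypotheses of `lehmann_goerisch_count` with this `ν`.
[folklore] -/
theorem lg_hypotheses_of_matrices
    (M N : LinearMap.BilinForm ℝ D) (bG : LinearMap.BilinForm ℝ X)
    (hM_symm : ∀ x y, M x y = M y x) (hN_symm : ∀ x y, N x y = N y x) (hbG_symm : ∀ x y, bG x y = bG y x)
    {n k : ℕ} (v : Fin n → D) (w : Fin n → X) (A0 A1 A2 : Matrix (Fin n) (Fin n) ℝ)
    (hA0 : ∀ i j, A0 i j = M (v i) (v j)) (hA1 : ∀ i j, A1 i j = N (v i) (v j))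
    (hA2 : ∀ i j, A2 i j = bG (w i) (w j))
    (Z : Matrix (Fin n) (Fin k) ℝ) (ρ ν : ℝ)
    (U : (Fin k → ℝ) →ₗ[ℝ] D) (W : (Fin k → ℝ) →ₗ[ℝ] X)
    (hU : ∀ y, U y = ∑ j, (Z *ᵥ y) j • v j) (hW : ∀ y, W y = ∑ j, (Z *ᵥ y) j • w j)
    (hAB : (ν • (Zᵀ * (A0 - (2 * ρ) • A1 + (ρ ^ 2) • A2) * Z) - Zᵀ * (A0 - ρ • A1) * Z).PosSemidef)
    (hB : (A0 - (2 * ρ) • A1 + (ρ ^ 2) • A2).PosDef)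
    (hZ : ∀ y : Fin k → ℝ, Z *ᵥ y = 0 → y = 0) :
    (∀ y, M (U y) (U y) - ρ * N (U y) (U y)
        ≤ ν * (M (U y) (U y) - 2 * ρ * N (U y) (U y) + ρ ^ 2 * bG (W y) (W y)))
    ∧ (∀ y, y ≠ 0 → 0 < M (U y) (U y) - 2 * ρ * N (U y) (U y) + ρ ^ 2 * bG (W y) (W y)) := by
  set Bm := A0 - (2 * ρ) • A1 + (ρ ^ 2) • A2 with hBm
  set Am := A0 - ρ • A1 with hAm
  have h0 : ∀ y, M (U y) (U y) = (Z *ᵥ y) ⬝ᵥ (A0 *ᵥ (Z *ᵥ y)) := fun y => by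
    rw [hU]; exact lg_bilin_combo M hM_symm v A0 hA0 _
  have h1 : ∀ y, N (U y) (U y) = (Z *ᵥ y) ⬝ᵥ (A1 *ᵥ (Z *ᵥ y)) := fun y => by
    rw [hU]; exact lg_bilin_combo N hN_symm v A1 hA1 _
  have h2 : ∀ y, bG (W y) (W y) = (Z *ᵥ y) ⬝ᵥ (A2 *ᵥ (Z *ᵥ y)) := fun y => by
    rw [hW]; exact lg_bilin_combo bG hbG_symm w A2 hA2 _
  have hBform : ∀ y, M (U y) (U y) - 2 * ρ * N (U y) (U y) + ρ ^ 2 * bG (W y) (W y)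
      = (Z *ᵥ y) ⬝ᵥ (Bm *ᵥ (Z *ᵥ y)) := by
    intro y
    rw [h0, h1, h2, hBm, Matrix.add_mulVec, Matrix.sub_mulVec, Matrix.smul_mulVec, Matrix.smul_mulVec,
      dotProduct_add, dotProduct_sub, dotProduct_smul, dotProduct_smul, smul_eq_mul, smul_eq_mul]
    try ring
  have hAform : ∀ y, M (U y) (U y) - ρ * N (U y) (U y) = (Z *ᵥ y) ⬝ᵥ (Am *ᵥ (Z *ᵥ y)) := by
    intro y
    rw [h0, h1, hAm, Matrix.sub_mulVec, Matrix.smul_mulVec, dotProduct_sub, dotProduct_smul, smul_eq_mul]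
    try ring
  refine ⟨fun y => ?_, fun y hy => ?_⟩
  · have h := (Matrix.posSemidef_iff_dotProduct_mulVec.mp hAB).2 y
    rw [star_trivial, Matrix.sub_mulVec, Matrix.smul_mulVec, dotProduct_sub, dotProduct_smul, smul_eq_mul,
      lg_congr_form, lg_congr_form] at h
    rw [hAform, hBform]
    linarith
  · have hx : Z *ᵥ y ≠ 0 := fun h => hy (hZ y h)
    have h := hB.re_dotProduct_pos hx
    simp only [star_trivial, RCLike.re_to_real] at h
    rw [hBform]
    exact h

/-- **From certified matrices to the hypothesis of `rayleigh_ritz_count`.** With the Gram matrices `A0 = (M(v_i,v_j))`, `A1 = (N(v_i,v_j))` and a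
coefficient matrix `Z` with trivial kernel: if `β ZᵀA1Z − ZᵀA0Z ≻ 0` (interval Cholesky of a `k × k` matrix), the family `U y = Σ_j (Zy)_j v_j` has
`M(Uy,Uy) < β N(Uy,Uy)` for `y ≠ 0`. [folklore] -/
theorem rr_hypothesis_of_matrices
    (M N : LinearMap.BilinForm ℝ D) (hM_symm : ∀ x y, M x y = M y x) (hN_symm : ∀ x y, N x y = N y x)
    {n k : ℕ} (v : Fin n → D) (A0 A1 : Matrix (Fin n) (Fin n) ℝ)
    (hA0 : ∀ i j, A0 i j = M (v i) (v j)) (hA1 : ∀ i j, A1 i j = N (v i) (v j))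
    (Z : Matrix (Fin n) (Fin k) ℝ) (β : ℝ)
    (U : (Fin k → ℝ) →ₗ[ℝ] D) (hU : ∀ y, U y = ∑ j, (Z *ᵥ y) j • v j)
    (hpos : (β • (Zᵀ * A1 * Z) - Zᵀ * A0 * Z).PosDef) :
    ∀ y, y ≠ 0 → M (U y) (U y) < β * N (U y) (U y) := by
  intro y hy
  have h0 : M (U y) (U y) = (Z *ᵥ y) ⬝ᵥ (A0 *ᵥ (Z *ᵥ y)) := by
    rw [hU]; exact lg_bilin_combo M hM_symm v A0 hA0 _
  have h1 : N (U y) (U y) = (Z *ᵥ y) ⬝ᵥ (A1 *ᵥ (Z *ᵥ y)) := by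
    rw [hU]; exact lg_bilin_combo N hN_symm v A1 hA1 _
  have h := hpos.re_dotProduct_pos hy
  simp only [star_trivial, RCLike.re_to_real] at h
  rw [Matrix.sub_mulVec, Matrix.smul_mulVec, dotProduct_sub, dotProduct_smul, smul_eq_mul,
    lg_congr_form, lg_congr_form] at h
  rw [h0, h1]
  linarith

end MatrixGlue

end Literature.Analysis.OperatorTheory
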